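import Summits.BirchSwinnertonDyer.Rank1Residual.WAll.TargetAtTwoThetaSlices
import Literature.NumberTheory.EllipticCurves.Newforms
import Literature.NumberTheory.EllipticCurves.CuspFormLFunction
import Literature.NumberTheory.Automorphic.Sweep1
import HarnessLib
import HarnessLib.Audit.Tags

/-!
# Rung W-ALL of ladder BSD (D-0120) — row 1 (`NonCMAtTwo`) SLICED along the WIDENED theta habitat
# «rank `0` ∧ good supersingular at `2` ∧ `a₂ = 0` ∧ `Δ < 0`» of the proposed sibling route
# `ThetaPartnerAtTwoHecke` (TP2⁺) / its complement (cell `bsd-wall`, lane (2), seat `bsd-wall-ty-1`;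
# new small file importing `WAll.TargetAtTwoThetaSlices` + the three Literature modules K0⁺ speaks in;
# director-bsd g9 ruling W-12 (a) 2026-08-27T12:19:14Z «GO — file TargetAtTwoThetaSlicesPlus.lean … by a typer NOW»)

HONEST FRAMING (cell `bsd-wall`, run/shared/lean/pub/bsd-wall/; brief `WALL-BRIEF-v1.md` sha16
b966bf16da27706e §2): STATEMENTS AND BOOKKEEPING ONLY — nothing asserted, nothing booked, no named
fact, no published theorem restated; the two `@[conjecture] def`s below are OPEN obligations and SLICES
of the registered row-1 leaf `Summit.BirchSwinnertonDyer.BirchSwinnertonDyer.Rank1Residual.NonCMAtTwo`.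

WHY THESE SLICES (planner seat `bsd-wall-p2` g6, memo `HOME/bsd-wall-p2/g6/HABITAT-WIDENING-TP2-v1.md`
+ v1.1 addendum 86c833fbc041d50f, sketch `g6/ThetaHecke_sketch.lean` bd57b3fa9e66ea04 rc 0; the
proposed text "for a ty seat (`Rank1Residual/WAll/TargetAtTwoThetaSlicesPlus.lean`), EXACT like §2 of
`TargetAtTwoThetaSlices`"). Route `ThetaPartnerAtTwo` (TP2) attacks the THETA HABITAT of row 1
(`WAllNonCMAtTwoThetaHabitat`: rank `0`, good supersingular at `2`, `a₂ = 0`, a rank-`0` CM elliptic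
partner `A` with `A[2] ≅ E[2]`; `19` of the `208` `a₂ = 0` rank-`0` classes of record, N < 5·10⁵). The
proposed sibling TP2⁺ replaces the CM CURVE `A` by a weight-`2` CM NEWFORM (Hecke theta series of the
resolvent field `ℚ(√Δ_E)`), which exists as soon as `Δ_E < 0` — the WIDENED habitat «rank `0` ∧
`GoodSS W 2` ∧ `a₂ = 0` ∧ `Δ < 0`» (`153` of the `208` classes; `W.Δ < 0` is isomorphism-invariant,
`Δ ↦ u¹²Δ`). This file puts that cut on the W-ALL books VERBATIM in the planner's spelling, so that the
sibling route can be born with `--closes-target Summit.BirchSwinnertonDyer.WAllNonCMAtTwoThetaHabitatPlus`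
and its complement is a registered-shape leaf.

| slice `Prop` (this file) | shape (all `∀ W [..] [..], ¬ W.HasCM → …`) | classes of record |
|---|---|---|
| `WAllNonCMAtTwoThetaHabitatPlus` | `… → r = 0 → GoodSS W 2 → a₂ = 0 → W.Δ < 0 → BSDp W 2` | `153` |
| `WAllNonCMAtTwoOffThetaHabitatPlus` | `… → r ≤ 1 → ¬ (r = 0 ∧ GoodSS W 2 ∧ a₂ = 0 ∧ Δ < 0) → BSDp W 2` | row 1 minus `153` |

* §1 the two slice `Prop`s (VERBATIM the planner's sketch);
* §2 glue (excluded middle only): `nonCMAtTwo_iff_thetaHabitatPlus_offThetaHabitatPlus` (EXACT), each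
  ⇐ row 1 ⇐ `WAll`; and the comparison with TP2's cut: under the planner's support statement
  `PartnerForcesNegDisc` ("a `2`-congruent CM partner good supersingular at `2` with `a₂ = 0` forces
  `Δ_E < 0`"; layer α of the memo, stated as an OPEN obligation here, NOT asserted) the habitat⁺ leaf
  implies TP2's habitat leaf (`thetaHabitat_of_plus`), i.e. TP2⁺'s target supersedes TP2's; the two
  OFF-leaves are not comparable (different partitions of row 1; only the conjunctions agree);
* §3 K0⁺ `HeckeThetaPartnerAtTwo` (OPEN obligation, VERBATIM the planner's sketch; rides in this file per
  W-12 (a) because it elaborates over EXISTING carriers only — `IsNewform0`, `IsCMForm`, `liftToGamma1`,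
  `cuspCoeff`, `completedCuspFormLContinuations` of `Literature/NumberTheory/EllipticCurves/Newforms.lean`,
  `…/CuspFormLFunction.lean`, `Literature/NumberTheory/Automorphic/Sweep1.lean`; no new notion): every
  curve on the habitat⁺ has a mod-`2` HECKE THETA PARTNER — an odd level `M`, a CM newform
  `g ∈ S₂(Γ₀(M))` with `a₂(g) = 0`, `Λ(g, 1) ≠ 0`, and a ring map from `ℤ[aₙ(g)]` to a field of
  characteristic `2` matching `a_ℓ(g)` with `a_ℓ(E)` for `ℓ ∤ 2·M·N_E`. The sibling route itself stays
  STAGED (W-12 (b)); this file only puts its leaf, its complement, its support and its K0⁺ on the books.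

References: `WAll/TargetAtTwoThetaSlices.lean` (p516700; TP2's cut), `WAll/Target.lean` (row 1),
`Theorems/Rank1ResidualX5TwoDefs.lean` (`NonCMAtTwo`), `Rank1Residual/Predicates.lean` (`GoodSS`);
HOME `bsd-wall-p2/g6/` (memos and sketch); [cite: Miller2011LMS, §1 and Def. 1.1] (the currency `BSD(E,p)`).
-/

noncomputable section

open scoped Classical

open WeierstrassCurve Literature.NumberTheory.EllipticCurves
  Literature.NumberTheory.EllipticCurves.Rank1Residual Literature.NumberTheory.EllipticCurves.ModularForms
open Summit.BirchSwinnertonDyer.BirchSwinnertonDyer.Rank1Residual (NonCMAtTwo)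
open Literature.NumberTheory.Automorphic (IsCMForm)

set_option autoImplicit false

namespace Summit.BirchSwinnertonDyer

/-! ### §1. Row 1 cut along the widened theta habitat «r = 0 ∧ ss at 2 ∧ a₂ = 0 ∧ Δ < 0» -/

/-- **Row 1 ON THE WIDENED THETA HABITAT (OPEN)**: non-CM `E/ℚ` of analytic rank `0`, good
supersingular at `2` with `a₂(E) = 0` and NEGATIVE minimal discriminant ⇒ `BSD(E,2)` — the target of
the proposed sibling route `ThetaPartnerAtTwoHecke` (`153` of the `208` `a₂ = 0` rank-`0` X5 classes of
record; contains TP2's `19`-class habitat under `thetaHabitat_of_plus`). VERBATIM the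
planner's sketch (bsd-wall-p2 g6). [folklore] -/
@[conjecture] def WAllNonCMAtTwoThetaHabitatPlus : Prop :=
  ∀ (W : WeierstrassCurve ℚ) [W.IsElliptic] [W.IsGloballyMinimal], ¬ W.HasCM →
    W.analyticRank = 0 → GoodSS W 2 → W.frobeniusTrace 2 = 0 → W.Δ < 0 → BSDp W 2

/-- **Row 1 OFF THE WIDENED THETA HABITAT (OPEN)**: every non-CM `E/ℚ` of analytic rank `≤ 1` that
is NOT (rank `0` ∧ good supersingular at `2` ∧ `a₂ = 0` ∧ `Δ < 0`) satisfies `BSD(E,2)` — the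
complement slice (every non-CM rank-`1` curve at `2`, every ordinary / multiplicative / additive-at-`2`
curve, the `a₂ = ±2` supersingular ones and the `a₂ = 0`, `Δ > 0` ones). VERBATIM the planner's
sketch. [folklore] -/
@[conjecture] def WAllNonCMAtTwoOffThetaHabitatPlus : Prop :=
  ∀ (W : WeierstrassCurve ℚ) [W.IsElliptic] [W.IsGloballyMinimal], ¬ W.HasCM →
    W.analyticRank ≤ 1 →
    ¬ (W.analyticRank = 0 ∧ GoodSS W 2 ∧ W.frobeniusTrace 2 = 0 ∧ W.Δ < 0) → BSDp W 2

/-! ### §2. Glue (excluded middle only) and the comparison with TP2's cut -/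

/-- **Row 1 ⟺ habitat⁺ ∧ off-habitat⁺** (excluded middle; EXACT). [folklore] -/
theorem nonCMAtTwo_iff_thetaHabitatPlus_offThetaHabitatPlus :
    NonCMAtTwo ↔ WAllNonCMAtTwoThetaHabitatPlus ∧ WAllNonCMAtTwoOffThetaHabitatPlus :=
  ⟨fun h ↦ ⟨fun W _ _ hcm hr _ _ _ ↦ h W hcm (by omega), fun W _ _ hcm hr _ ↦ h W hcm hr⟩,
    fun ⟨hHab, hOff⟩ W _ _ hcm hr ↦ by
      by_cases hH : (W.analyticRank = 0 ∧ GoodSS W 2 ∧ W.frobeniusTrace 2 = 0 ∧ W.Δ < 0)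
      · exact hHab W hcm hH.1 hH.2.1 hH.2.2.1 hH.2.2.2
      · exact hOff W hcm hr hH⟩

/-- Row 1 from its two widened slices. [folklore] -/
theorem nonCMAtTwo_of_thetaHabitatPlus_of_offThetaHabitatPlus (hHab : WAllNonCMAtTwoThetaHabitatPlus)
    (hOff : WAllNonCMAtTwoOffThetaHabitatPlus) : NonCMAtTwo :=
  nonCMAtTwo_iff_thetaHabitatPlus_offThetaHabitatPlus.2 ⟨hHab, hOff⟩

/-- Conversely row 1 restricts to both widened slices. [folklore] -/
theorem thetaSlicesPlus_of_nonCMAtTwo (h : NonCMAtTwo) :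
    WAllNonCMAtTwoThetaHabitatPlus ∧ WAllNonCMAtTwoOffThetaHabitatPlus :=
  nonCMAtTwo_iff_thetaHabitatPlus_offThetaHabitatPlus.1 h

/-- … and both follow from `WAll`. [folklore] -/
theorem thetaSlicesPlus_of_wAll (h : WAll) :
    WAllNonCMAtTwoThetaHabitatPlus ∧ WAllNonCMAtTwoOffThetaHabitatPlus :=
  thetaSlicesPlus_of_nonCMAtTwo fun W _ _ _ hr ↦ h W 2 hr

/-- The widened slices give back TP2's slices (both pairs are EXACTLY row 1). [folklore] -/
theorem thetaSlices_of_thetaSlicesPlus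
    (h : WAllNonCMAtTwoThetaHabitatPlus ∧ WAllNonCMAtTwoOffThetaHabitatPlus) :
    WAllNonCMAtTwoThetaHabitat ∧ WAllNonCMAtTwoOffThetaHabitat :=
  thetaSlices_of_nonCMAtTwo (nonCMAtTwo_iff_thetaHabitatPlus_offThetaHabitatPlus.2 h)

/-- **Support statement (layer α of the planner's memo; OPEN obligation here, NOT asserted; the planner
records it as provable from the tree's `2`-torsion Galois module)**: a `Γ_ℚ`-equivariant `E[2] ≃ A[2]`
with a CM curve `A/ℚ` good supersingular at `2`, `a₂(A) = 0`, forces `Δ_E < 0` (`ℚ(A[2]) ⊇ K_A`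
imaginary quadratic = `ℚ(√Δ_A)` = the resolvent of the `2`-division cubic, a `2`-torsion Galois
invariant). VERBATIM the planner's sketch. [folklore] -/
@[conjecture] def PartnerForcesNegDisc : Prop :=
  ∀ (W : WeierstrassCurve ℚ) [W.IsElliptic] [W.IsGloballyMinimal] (A : WeierstrassCurve ℚ)
    [A.IsElliptic] [A.IsGloballyMinimal], ¬ W.HasCM → GoodSS W 2 → W.frobeniusTrace 2 = 0 →
    A.HasCM → GoodSS A 2 → A.frobeniusTrace 2 = 0 →
    (∃ e : WeierstrassCurve.geomTorsion W (2 : ℤ) ≃+ WeierstrassCurve.geomTorsion A (2 : ℤ),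
        ∀ (σ : Field.absoluteGaloisGroup ℚ) (P : WeierstrassCurve.geomTorsion W (2 : ℤ)),
          e (σ • P) = σ • e P) →
    W.Δ < 0

/-- **TP2⁺'s target supersedes TP2's**: granted `PartnerForcesNegDisc`, the habitat⁺ leaf implies TP2's
habitat leaf `WAllNonCMAtTwoThetaHabitat`. VERBATIM the planner's sketch. [folklore] -/
theorem thetaHabitat_of_plus (hplus : WAllNonCMAtTwoThetaHabitatPlus) (hneg : PartnerForcesNegDisc) :
    WAllNonCMAtTwoThetaHabitat := by
  intro W _ _ hCM hr hss ha2 hA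
  obtain ⟨A, hAe, hAm, hACM, -, hAss, hAa2, e, he⟩ := hA
  exact hplus W hCM hr hss ha2 (hneg W A hCM hss ha2 hACM hAss hAa2 ⟨e, he⟩)

/-! ### §3. K0⁺ — the mod-2 Hecke theta partner (OPEN obligation of the staged sibling route) -/

/-- **K0⁺ (partner existence; OPEN obligation, nothing asserted)**: every curve on the habitat⁺ has a
MOD-`2` HECKE THETA PARTNER: an odd level `M`, a newform `g ∈ S₂(Γ₀(M))` with complex multiplication,
`a₂(g) = 0`, `Λ(g, 1) ≠ 0` (via the entire continuation — no junk `tsum`), and a ring map `φ` from the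
order `ℤ[aₙ(g) : n]` to a field of characteristic `2` with `φ(a_ℓ(g)) = a_ℓ(W)` for every prime
`ℓ ∤ 2·M·N_W` (⟺ `ρ̄_{g,λ} ≅ W[2] ⊗ k` by Brauer–Nesbitt, `W[2]` being absolutely irreducible with image
`S₃` when `Δ_W` is not a square). The planner's sources for the expected proof: Hecke 1926 / Shimura 1971 /
Ribet 1977 (theta series of Grössencharaktere of `ℚ(√Δ_W)`), Rohrlich's canonical characters, a rank-`0`
twist. VERBATIM the planner's sketch (bsd-wall-p2 g6, `g6/ThetaHecke_sketch.lean` bd57b3fa9e66ea04).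
[folklore] -/
@[conjecture] def HeckeThetaPartnerAtTwo : Prop :=
  ∀ (W : WeierstrassCurve ℚ) [W.IsElliptic] [W.IsGloballyMinimal], ¬ W.HasCM →
    W.analyticRank = 0 → GoodSS W 2 → W.frobeniusTrace 2 = 0 → W.Δ < 0 →
    ∃ (M : ℕ) (_ : NeZero M) (g : CuspForm (CongruenceSubgroup.Gamma0 M) 2),
      Odd M ∧ IsNewform0 g ∧ IsCMForm (liftToGamma1 M 2 g) ∧ cuspCoeff g 2 = 0 ∧
      (∃ Λ ∈ completedCuspFormLContinuations M g, Λ 1 ≠ 0) ∧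
      ∃ (k : Type) (_ : Field k) (_ : CharP k 2)
        (φ : Algebra.adjoin ℤ (Set.range fun n : ℕ => cuspCoeff g n) →+* k),
        ∀ ℓ : ℕ, ℓ.Prime → ¬ ℓ ∣ 2 * M * W.conductorNorm ℤ →
          φ ⟨cuspCoeff g ℓ, Algebra.subset_adjoin ⟨ℓ, rfl⟩⟩ = (W.frobeniusTrace ℓ : k)

end Summit.BirchSwinnertonDyer

end
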